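import Summits.BirchSwinnertonDyer.BirchSwinnertonDyer.Theorems.ResidualThetaTransportAtTwoThetaLayerLambdaCongruenceAtTwoCuspSpanGeneration
import HarnessLib

/-!
# Route `ResidualThetaTransportAtTwo`, cruxes Kan⁺ (stmt-BirchSwinnertonDyer-20688) / Kμ⁺ / 21437: the node (G′)_N at PRIME-POWER
# levels reduces to the values of `χ` on ONE explicit family `β(δ) = (α, −1; Nκ, δ)`, and a three-term rule on those values —
# the interface for per-level certificates at `p ≡ 5 (mod 8)` (outside Theorem A)

Cell `bsd-wall`, lead prover `bsd-wall-rtt-p3` g9 (2026-08-28). THEOREMS ONLY; `--supports stmt-BirchSwinnertonDyer-20688`; BSD is not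
proved by this. Sequel to `…CuspSpanGeneration` (Theorem A, p618977).

* §1 `chi_eq_of_apply_zero_one_eq_neg_one` — for `β, β' ∈ Γ₀(N)` with upper-right entry `−1` and `d(β) ≡ d(β') (mod N)`,
  `χ β = χ β'` (`β' = L_t β L_{t'}`): on the family `B₁` the character `χ` is a function `f` of `d mod N` alone.
* §2 `chi_eq_zero_of_forall_b1` — DESCENT at prime powers (hypothesis (SUCC) only, every odd prime): if `χ` kills every element with
  `|b| = 1` then `χ = 0`. So (G″)_{p^e} ⟺ `f ≡ 0` … (with `ψ = 0`; the Eisenstein case `p ≡ 1 (mod 8)` needs `f` = a character, not treated).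
* §3 seeds and the THREE-TERM RULE: `f(d) = 0` for `d ≡ ±4^k` (the `L_t`-adjustment of Theorem A) and for `d` with `d² + td + 1 ≡ 0`,
  `t ∈ {0, ±1}` (an elliptic element of `B₁`); and for `β₁ = (a₁, −1; c₁, d₁)`, `β₂ = (a₂, −1; c₂, d₂)` with `a₁ + d₂ = η ∈ {±1}` the product
  `β₁β₂` lies in `B₁^{∓}` with `d ≡ d₁d₂`: any two of `f(u)`, `f(η − u⁻¹)`, `f((ηu − 1)^η)` vanish ⟹ the third does.
* §4 residue-class bookkeeping `K_pow`, `K_ell`, `K_rule_pos`, `K_rule_neg` ("χ kills every `b = −1` element with `d ≡ r`"), the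
  interface of the per-level certificates (`…CuspSpanCert29`: the closure of the seeds under the rule is all of `(ℤ/29)^×`; likewise for
  13, 25, 37, 53, 101, 125, 169, 181, 197, …; NOT for 17, 31, 41, 43, 61, …).

References: [Rademacher1929] (generators of `Γ₀(p)`); [Knapp1993] Prop. 11.1, 11.22; [Pollack2003] Conj. 6.3.
-/

set_option autoImplicit false
set_option linter.dupNamespace false

noncomputable section

open scoped MatrixGroups

open CongruenceSubgroup

namespace Summit.BirchSwinnertonDyer.BirchSwinnertonDyer.Theorems.SignedMuAtTwo

variable {N : ℕ} {χ : Gamma0 N → ZMod 2}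

/-! ## §1. On `B₁ = {b = −1}` the character is a function of `d mod N` -/

/-- Upper-left entry of a product: `(γδ)₀₀ = γ₀₀ δ₀₀ + γ₀₁ δ₁₀`. [folklore] -/
theorem gamma0_mul_apply_zero_zero' (γ δ : Gamma0 N) :
    ((γ * δ : Gamma0 N) : SL(2, ℤ)) 0 0 =
      (γ : SL(2, ℤ)) 0 0 * (δ : SL(2, ℤ)) 0 0 + (γ : SL(2, ℤ)) 0 1 * (δ : SL(2, ℤ)) 1 0 :=
  (Matrix.two_mul_expl ((γ : SL(2, ℤ)) : Matrix (Fin 2) (Fin 2) ℤ)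
    ((δ : SL(2, ℤ)) : Matrix (Fin 2) (Fin 2) ℤ)).1

/-- Two elements of `Γ₀(N)` with the same upper-right entry `−1`, the same `a` and the same `d` are equal (`c = 1 − ad`). [folklore] -/
theorem gamma0_eq_of_b_neg_one {β β' : Gamma0 N} (hb : (β : SL(2, ℤ)) 0 1 = -1) (hb' : (β' : SL(2, ℤ)) 0 1 = -1)
    (ha : (β : SL(2, ℤ)) 0 0 = (β' : SL(2, ℤ)) 0 0) (hd : (β : SL(2, ℤ)) 1 1 = (β' : SL(2, ℤ)) 1 1) : β = β' := by
  have h1 := Matrix.SpecialLinearGroup.det_coe (β : SL(2, ℤ))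
  have h2 := Matrix.SpecialLinearGroup.det_coe (β' : SL(2, ℤ))
  rw [Matrix.det_fin_two] at h1 h2
  refine ThetaLayerLambdaCongruenceAtTwo.gamma0_ext ha (by rw [hb, hb']) ?_ hd
  rw [hb] at h1; rw [hb'] at h2
  rw [ha, hd] at h1
  linear_combination h1 - h2

/-- **On `B₁` the character depends only on `d mod N`.** For additive `χ` killing the small-trace elements and `β, β' ∈ Γ₀(N)` with
upper-right entry `−1` and `d(β) ≡ d(β') (mod N)`: `χ β = χ β'` — indeed `β' = L_t β L_{t'}` with `L_s = (1 0; Ns 1)` parabolic.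
[folklore] -/
theorem chi_eq_of_apply_zero_one_eq_neg_one
    (hadd : ∀ γ δ : Gamma0 N, χ (γ * δ) = χ γ + χ δ)
    (hsmall : ∀ γ : Gamma0 N, ((γ : SL(2, ℤ)) 0 0 + (γ : SL(2, ℤ)) 1 1).natAbs ≤ 2 → χ γ = 0)
    {β β' : Gamma0 N} (hb : (β : SL(2, ℤ)) 0 1 = -1) (hb' : (β' : SL(2, ℤ)) 0 1 = -1)
    (hd : (((β : SL(2, ℤ)) 1 1 : ℤ) : ZMod N) = (((β' : SL(2, ℤ)) 1 1 : ℤ) : ZMod N)) : χ β = χ β' := by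
  -- `d' = d - tN`, `a' = a - t'N`
  obtain ⟨t, ht⟩ : (N : ℤ) ∣ (β : SL(2, ℤ)) 1 1 - (β' : SL(2, ℤ)) 1 1 :=
    (ZMod.intCast_zmod_eq_zero_iff_dvd _ N).mp (by push_cast; rw [hd, sub_self])
  have hda : (((β : SL(2, ℤ)) 1 1 : ℤ) : ZMod N) * (((β : SL(2, ℤ)) 0 0 : ℤ) : ZMod N) = 1 :=
    gamma0_apply_one_one_mul_apply_zero_zero β
  have hda' : (((β' : SL(2, ℤ)) 1 1 : ℤ) : ZMod N) * (((β' : SL(2, ℤ)) 0 0 : ℤ) : ZMod N) = 1 :=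
    gamma0_apply_one_one_mul_apply_zero_zero β'
  have ha : (((β : SL(2, ℤ)) 0 0 : ℤ) : ZMod N) = (((β' : SL(2, ℤ)) 0 0 : ℤ) : ZMod N) := by
    -- both are the inverse of the same unit
    have hu := isUnit_gamma0_apply_one_one β
    rw [hd] at hda
    calc (((β : SL(2, ℤ)) 0 0 : ℤ) : ZMod N)
        = ((((β' : SL(2, ℤ)) 1 1 : ℤ) : ZMod N) * (((β' : SL(2, ℤ)) 0 0 : ℤ) : ZMod N)) *
            (((β : SL(2, ℤ)) 0 0 : ℤ) : ZMod N) := by rw [hda', one_mul]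
      _ = ((((β' : SL(2, ℤ)) 1 1 : ℤ) : ZMod N) * (((β : SL(2, ℤ)) 0 0 : ℤ) : ZMod N)) *
            (((β' : SL(2, ℤ)) 0 0 : ℤ) : ZMod N) := by ring
      _ = (((β' : SL(2, ℤ)) 0 0 : ℤ) : ZMod N) := by rw [hda, one_mul]
  obtain ⟨t', ht'⟩ : (N : ℤ) ∣ (β : SL(2, ℤ)) 0 0 - (β' : SL(2, ℤ)) 0 0 :=
    (ZMod.intCast_zmod_eq_zero_iff_dvd _ N).mp (by push_cast; rw [ha, sub_self])
  obtain ⟨L, hL00, hL01, hL10, hL11⟩ :=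
    ThetaLayerLambdaCongruenceAtTwo.exists_gamma0_entries (N := N) 1 0 ((N : ℤ) * t) 1 (by ring) (dvd_mul_right _ _)
  obtain ⟨L', hL'00, hL'01, hL'10, hL'11⟩ :=
    ThetaLayerLambdaCongruenceAtTwo.exists_gamma0_entries (N := N) 1 0 ((N : ℤ) * t') 1 (by ring) (dvd_mul_right _ _)
  have hL : χ L = 0 := hsmall L (by rw [hL00, hL11]; rfl)
  have hL' : χ L' = 0 := hsmall L' (by rw [hL'00, hL'11]; rfl)
  -- `L β L' = β'`
  have hprod : L * β * L' = β' := by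
    have e01 : ((L * β : Gamma0 N) : SL(2, ℤ)) 0 1 = -1 := by
      rw [gamma0_mul_apply_zero_one, hL00, hL01, hb]; ring
    have e00 : ((L * β : Gamma0 N) : SL(2, ℤ)) 0 0 = (β : SL(2, ℤ)) 0 0 := by
      rw [gamma0_mul_apply_zero_zero', hL00, hL01]; ring
    have e11 : ((L * β : Gamma0 N) : SL(2, ℤ)) 1 1 = (β : SL(2, ℤ)) 1 1 - N * t := by
      rw [gamma0_mul_apply_one_one', hL10, hL11, hb]; ring
    have f01 : ((L * β * L' : Gamma0 N) : SL(2, ℤ)) 0 1 = -1 := by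
      rw [gamma0_mul_apply_zero_one, e00, e01, hL'01, hL'11]; ring
    have f00 : ((L * β * L' : Gamma0 N) : SL(2, ℤ)) 0 0 = (β' : SL(2, ℤ)) 0 0 := by
      rw [gamma0_mul_apply_zero_zero', e00, e01, hL'00, hL'10]; linear_combination ht'
    have f11 : ((L * β * L' : Gamma0 N) : SL(2, ℤ)) 1 1 = (β' : SL(2, ℤ)) 1 1 := by
      rw [gamma0_mul_apply_one_one', hL'01, mul_zero, zero_add, e11, hL'11]; linear_combination ht
    exact gamma0_eq_of_b_neg_one f01 hb' f00 f11
  rw [← hprod, hadd, hadd, hL, hL', zero_add, add_zero]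

/-! ## §2. Descent at prime powers from the `B₁`-values alone -/

/-- **Descent.** Under (SUCC) (of two consecutive integers one is a unit mod `N`, i.e. `N` a prime power): if the additive `χ` kills the
small-trace elements and EVERY element of `Γ₀(N)` with upper-right entry `±1`, then `χ = 0` (the descent of Theorem A, verbatim, with the
`|b| = 1` step as hypothesis). [cite: Rademacher1929, §1] -/
theorem chi_eq_zero_of_forall_b1
    (hsucc : ∀ δ : ℤ, IsUnit ((δ : ℤ) : ZMod N) ∨ IsUnit (((δ + 1 : ℤ)) : ZMod N))
    (hadd : ∀ γ δ : Gamma0 N, χ (γ * δ) = χ γ + χ δ)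
    (hsmall : ∀ γ : Gamma0 N, ((γ : SL(2, ℤ)) 0 0 + (γ : SL(2, ℤ)) 1 1).natAbs ≤ 2 → χ γ = 0)
    (hB1 : ∀ β : Gamma0 N, ((β : SL(2, ℤ)) 0 1).natAbs = 1 → χ β = 0) :
    ∀ γ : Gamma0 N, χ γ = 0 := by
  suffices h : ∀ n : ℕ, ∀ γ : Gamma0 N, ((γ : SL(2, ℤ)) 0 1).natAbs = n → χ γ = 0 from fun γ ↦ h _ γ rfl
  intro n
  induction n using Nat.strong_induction_on with
  | _ n ih =>
  intro γ hn
  have hdet : (γ : SL(2, ℤ)) 0 0 * (γ : SL(2, ℤ)) 1 1 - (γ : SL(2, ℤ)) 0 1 * (γ : SL(2, ℤ)) 1 0 = 1 := by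
    have := Matrix.SpecialLinearGroup.det_coe (γ : SL(2, ℤ))
    rwa [Matrix.det_fin_two] at this
  rcases Nat.lt_or_ge n 2 with hlt | hge
  · interval_cases n
    · have hb0 : (γ : SL(2, ℤ)) 0 1 = 0 := Int.natAbs_eq_zero.mp hn
      rw [hb0, zero_mul, sub_zero] at hdet
      refine hsmall γ ?_
      rcases Int.eq_one_or_neg_one_of_mul_eq_one' hdet with ⟨ha, hd⟩ | ⟨ha, hd⟩ <;> rw [ha, hd] <;> rfl
    · exact hB1 γ hn
  · have hcop : IsCoprime ((γ : SL(2, ℤ)) 0 0) ((γ : SL(2, ℤ)) 0 1) :=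
      ⟨(γ : SL(2, ℤ)) 1 1, -(γ : SL(2, ℤ)) 1 0, by linear_combination hdet⟩
    obtain ⟨δ, hδu, hlt⟩ := exists_unit_natAbs_mul_sub_lt hsucc hcop (hn ▸ hge)
    obtain ⟨u, v, huv⟩ := (ZMod.coe_int_isUnit_iff_isCoprime δ N).mp hδu
    obtain ⟨β, hβ00, hβ01, hβ10, hβ11⟩ := ThetaLayerLambdaCongruenceAtTwo.exists_gamma0_entries (N := N) v (-1)
      ((N : ℤ) * u) δ (by linear_combination huv) (dvd_mul_right _ _)
    have hβ : χ β = 0 := hB1 β (by rw [hβ01]; rfl)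
    have hγβ : ((γ * β : Gamma0 N) : SL(2, ℤ)) 0 1 = (γ : SL(2, ℤ)) 0 1 * δ - (γ : SL(2, ℤ)) 0 0 := by
      rw [gamma0_mul_apply_zero_one, hβ01, hβ11]; ring
    have hlt' : (((γ * β : Gamma0 N) : SL(2, ℤ)) 0 1).natAbs < n := by rw [hγβ, ← hn]; exact hlt
    exact chi_eq_zero_of_mul_right hadd (ih _ hlt' (γ * β) rfl) hβ

/-- `B₁⁺` reduces to `B₁⁻`: an element with upper-right entry `+1` is the inverse of one with upper-right entry `−1` whose `d` is its `a`.
So if `χ` kills every `b = −1` element it kills every `|b| = 1` element. [folklore] -/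
theorem forall_b1_of_forall_b_neg_one (hadd : ∀ γ δ : Gamma0 N, χ (γ * δ) = χ γ + χ δ)
    (h : ∀ β : Gamma0 N, (β : SL(2, ℤ)) 0 1 = -1 → χ β = 0) :
    ∀ β : Gamma0 N, ((β : SL(2, ℤ)) 0 1).natAbs = 1 → χ β = 0 := by
  intro β hb
  rcases Int.natAbs_eq_natAbs_iff.mp (show ((β : SL(2, ℤ)) 0 1).natAbs = (1 : ℤ).natAbs from hb) with h1 | h1
  · -- `b = 1`: use the inverse
    have hinv : ((β⁻¹ : Gamma0 N) : SL(2, ℤ)) 0 1 = -1 := by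
      have e : ((β⁻¹ : Gamma0 N) : SL(2, ℤ)) 0 1 = -((β : SL(2, ℤ)) 0 1) := by
        rw [InvMemClass.coe_inv, Matrix.SpecialLinearGroup.SL2_inv_expl]; rfl
      rw [e, h1]
    have h0 := h β⁻¹ hinv
    have h1' : χ 1 = 0 := by have := hadd 1 1; rw [mul_one] at this; linear_combination (-1 : ZMod 2) * this
    have := hadd β β⁻¹
    rw [mul_inv_cancel, h1', h0, add_zero] at this
    exact this.symm
  · exact h β h1

/-! ## §3. Seeds and the three-term rule for the values on `B₁` -/

/-- **Seed (powers of 4).** If `d(β) ≡ ±4^k (mod N)` (`k ≥ 1`) and `b(β) = −1` then `χ β = 0` (the `L_t`-adjustment).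
[cite: Rademacher1929, §1] -/
theorem chi_eq_zero_of_b_neg_one_of_d_eq_four_pow
    (hadd : ∀ γ δ : Gamma0 N, χ (γ * δ) = χ γ + χ δ)
    (hsmall : ∀ γ : Gamma0 N, ((γ : SL(2, ℤ)) 0 0 + (γ : SL(2, ℤ)) 1 1).natAbs ≤ 2 → χ γ = 0)
    (hkill : ∀ γ : Gamma0 N, (∃ k : ℕ, 1 ≤ k ∧ ((γ : SL(2, ℤ)) 1 1).natAbs = 4 ^ k) → χ γ = 0)
    (β : Gamma0 N) (hb : (β : SL(2, ℤ)) 0 1 = -1) (k : ℕ) (hk : 1 ≤ k) (ε : ℤ) (hε : ε.natAbs = 1)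
    (hd : (((β : SL(2, ℤ)) 1 1 : ℤ) : ZMod N) = ((ε * 4 ^ k : ℤ) : ZMod N)) : χ β = 0 := by
  obtain ⟨t₀, ht₀⟩ : (N : ℤ) ∣ (β : SL(2, ℤ)) 1 1 - ε * 4 ^ k :=
    (ZMod.intCast_zmod_eq_zero_iff_dvd _ N).mp (by push_cast at hd ⊢; rw [hd, sub_self])
  obtain ⟨L, hL00, hL01, hL10, hL11⟩ :=
    ThetaLayerLambdaCongruenceAtTwo.exists_gamma0_entries (N := N) 1 0 ((N : ℤ) * t₀) 1 (by ring) (dvd_mul_right _ _)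
  have hL : χ L = 0 := hsmall L (by rw [hL00, hL11]; rfl)
  have hLβ : ((L * β : Gamma0 N) : SL(2, ℤ)) 1 1 = ε * 4 ^ k := by
    rw [gamma0_mul_apply_one_one', hL10, hL11, hb]; linear_combination ht₀
  exact chi_eq_zero_of_mul_left hadd (hkill _ ⟨k, hk, by rw [hLβ, Int.natAbs_mul, hε, one_mul, Int.natAbs_pow]; rfl⟩) hL

/-- **Seed (elliptic).** If `d² + t d + 1 ≡ 0 (mod N)` with `t ∈ {0, 1, −1}` then the element `(−d − t, −1; d² + td + 1, d)` of `Γ₀(N)` has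
trace `−t`, so `χ` kills it, hence kills every `b = −1` element with that `d mod N`. [cite: Knapp1993, Prop. 11.1] -/
theorem chi_eq_zero_of_b_neg_one_of_elliptic
    (hadd : ∀ γ δ : Gamma0 N, χ (γ * δ) = χ γ + χ δ)
    (hsmall : ∀ γ : Gamma0 N, ((γ : SL(2, ℤ)) 0 0 + (γ : SL(2, ℤ)) 1 1).natAbs ≤ 2 → χ γ = 0)
    (β : Gamma0 N) (hb : (β : SL(2, ℤ)) 0 1 = -1) (d t : ℤ) (ht : t.natAbs ≤ 1) (hN : (N : ℤ) ∣ d * d + t * d + 1)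
    (hd : (((β : SL(2, ℤ)) 1 1 : ℤ) : ZMod N) = ((d : ℤ) : ZMod N)) : χ β = 0 := by
  obtain ⟨e, he00, he01, he10, he11⟩ :=
    ThetaLayerLambdaCongruenceAtTwo.exists_gamma0_entries (N := N) (-d - t) (-1) (d * d + t * d + 1) d (by ring) hN
  have he : χ e = 0 := hsmall e (by rw [he00, he11]; ring_nf; omega)
  rw [chi_eq_of_apply_zero_one_eq_neg_one hadd hsmall hb he01 (by rw [hd, he11]), he]

/-- **Three-term rule (`η = +1`).** For `b = −1` elements `β₁ = (a₁, −1; c₁, d₁)`, `β₂` with `a₁ + d(β₂) = 1`: `β₁ β₂` has upper-right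
entry `−1` and `d ≡ d₁ d(β₂) (mod N)`; so for any `b = −1` element `β₃` with `d(β₃) ≡ d₁ d(β₂)`: `χ β₁ + χ β₂ = χ β₃`. [folklore] -/
theorem chi_add_chi_eq_of_pos (hadd : ∀ γ δ : Gamma0 N, χ (γ * δ) = χ γ + χ δ)
    (hsmall : ∀ γ : Gamma0 N, ((γ : SL(2, ℤ)) 0 0 + (γ : SL(2, ℤ)) 1 1).natAbs ≤ 2 → χ γ = 0)
    {β₁ β₂ β₃ : Gamma0 N} (h1 : (β₁ : SL(2, ℤ)) 0 1 = -1) (h2 : (β₂ : SL(2, ℤ)) 0 1 = -1) (h3 : (β₃ : SL(2, ℤ)) 0 1 = -1)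
    (h12 : (β₁ : SL(2, ℤ)) 0 0 + (β₂ : SL(2, ℤ)) 1 1 = 1)
    (hd : (((β₃ : SL(2, ℤ)) 1 1 : ℤ) : ZMod N) = (((β₁ : SL(2, ℤ)) 1 1 * (β₂ : SL(2, ℤ)) 1 1 : ℤ) : ZMod N)) :
    χ β₁ + χ β₂ = χ β₃ := by
  have hb : ((β₁ * β₂ : Gamma0 N) : SL(2, ℤ)) 0 1 = -1 := by
    rw [gamma0_mul_apply_zero_one, h1, h2]; linear_combination (-1 : ℤ) * h12
  have hc : (((β₁ : SL(2, ℤ)) 1 0 : ℤ) : ZMod N) = 0 := by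
    have := β₁.2; rw [Gamma0_mem] at this; exact_mod_cast this
  have hdd : ((((β₁ * β₂ : Gamma0 N) : SL(2, ℤ)) 1 1 : ℤ) : ZMod N) = (((β₃ : SL(2, ℤ)) 1 1 : ℤ) : ZMod N) := by
    rw [gamma0_mul_apply_one_one', h2, hd]; push_cast; rw [hc]; ring
  rw [← hadd, chi_eq_of_apply_zero_one_eq_neg_one hadd hsmall hb h3 hdd]

/-- **Three-term rule (`η = −1`).** For `b = −1` elements `β₁, β₂` with `a(β₁) + d(β₂) = −1`: `(β₁β₂)⁻¹` has upper-right entry `−1` and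
`d = a(β₁β₂) ≡ a(β₁) a(β₂)`; so for any `b = −1` element `β₃` with `d(β₃) ≡ a(β₁) a(β₂)`: `χ β₁ + χ β₂ = χ β₃`. [folklore] -/
theorem chi_add_chi_eq_of_neg (hadd : ∀ γ δ : Gamma0 N, χ (γ * δ) = χ γ + χ δ)
    (hsmall : ∀ γ : Gamma0 N, ((γ : SL(2, ℤ)) 0 0 + (γ : SL(2, ℤ)) 1 1).natAbs ≤ 2 → χ γ = 0)
    {β₁ β₂ β₃ : Gamma0 N} (h1 : (β₁ : SL(2, ℤ)) 0 1 = -1) (h2 : (β₂ : SL(2, ℤ)) 0 1 = -1) (h3 : (β₃ : SL(2, ℤ)) 0 1 = -1)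
    (h12 : (β₁ : SL(2, ℤ)) 0 0 + (β₂ : SL(2, ℤ)) 1 1 = -1)
    (hd : (((β₃ : SL(2, ℤ)) 1 1 : ℤ) : ZMod N) = (((β₁ : SL(2, ℤ)) 0 0 * (β₂ : SL(2, ℤ)) 0 0 : ℤ) : ZMod N)) :
    χ β₁ + χ β₂ = χ β₃ := by
  have hb : ((β₁ * β₂ : Gamma0 N) : SL(2, ℤ)) 0 1 = 1 := by
    rw [gamma0_mul_apply_zero_one, h1, h2]; linear_combination (-1 : ℤ) * h12
  have hinvb : (((β₁ * β₂)⁻¹ : Gamma0 N) : SL(2, ℤ)) 0 1 = -1 := by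
    have e : (((β₁ * β₂)⁻¹ : Gamma0 N) : SL(2, ℤ)) 0 1 = -(((β₁ * β₂ : Gamma0 N) : SL(2, ℤ)) 0 1) := by
      rw [InvMemClass.coe_inv, Matrix.SpecialLinearGroup.SL2_inv_expl]; rfl
    rw [e, hb]
  have hc : (((β₂ : SL(2, ℤ)) 1 0 : ℤ) : ZMod N) = 0 := by
    have := β₂.2; rw [Gamma0_mem] at this; exact_mod_cast this
  have hinvd : (((((β₁ * β₂)⁻¹ : Gamma0 N) : SL(2, ℤ)) 1 1 : ℤ) : ZMod N) = (((β₃ : SL(2, ℤ)) 1 1 : ℤ) : ZMod N) := by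
    rw [coe_inv_apply_one_one, gamma0_mul_apply_zero_zero', h1, hd]; push_cast; rw [hc]; ring
  have h1' : χ 1 = 0 := by have := hadd 1 1; rw [mul_one] at this; linear_combination (-1 : ZMod 2) * this
  have hinv : χ (β₁ * β₂)⁻¹ = χ (β₁ * β₂) := by
    have := hadd (β₁ * β₂) (β₁ * β₂)⁻¹
    rw [mul_inv_cancel, h1'] at this
    have e : χ (β₁ * β₂)⁻¹ = -χ (β₁ * β₂) := by linear_combination (-1 : ZMod 2) * this
    rw [e, ZMod.neg_eq_self_mod_two]
  rw [← hadd, ← hinv, chi_eq_of_apply_zero_one_eq_neg_one hadd hsmall hinvb h3 hinvd]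


/-! ## §4. Residue-class bookkeeping ("K r": χ kills every `b = −1` element with `d ≡ r`) -/

/-- `K(r)` for `r = ε·4^k`, `k ≥ 1`. [cite: Rademacher1929, §1] -/
theorem K_pow (hadd : ∀ γ δ : Gamma0 N, χ (γ * δ) = χ γ + χ δ)
    (hsmall : ∀ γ : Gamma0 N, ((γ : SL(2, ℤ)) 0 0 + (γ : SL(2, ℤ)) 1 1).natAbs ≤ 2 → χ γ = 0)
    (hkill : ∀ γ : Gamma0 N, (∃ k : ℕ, 1 ≤ k ∧ ((γ : SL(2, ℤ)) 1 1).natAbs = 4 ^ k) → χ γ = 0)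
    (k : ℕ) (hk : 1 ≤ k) (ε : ℤ) (hε : ε.natAbs = 1) (r : ZMod N) (hr : ((ε * 4 ^ k : ℤ) : ZMod N) = r) :
    ∀ β : Gamma0 N, (β : SL(2, ℤ)) 0 1 = -1 → ((((β : SL(2, ℤ)) 1 1 : ℤ) : ZMod N)) = r → χ β = 0 :=
  fun β hb hd ↦ chi_eq_zero_of_b_neg_one_of_d_eq_four_pow hadd hsmall hkill β hb k hk ε hε (by rw [hd, hr])

/-- `K(r)` for an elliptic residue `r` (`r² + tr + 1 ≡ 0`, `|t| ≤ 1`). [cite: Knapp1993, Prop. 11.1] -/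
theorem K_ell (hadd : ∀ γ δ : Gamma0 N, χ (γ * δ) = χ γ + χ δ)
    (hsmall : ∀ γ : Gamma0 N, ((γ : SL(2, ℤ)) 0 0 + (γ : SL(2, ℤ)) 1 1).natAbs ≤ 2 → χ γ = 0)
    (d t : ℤ) (ht : t.natAbs ≤ 1) (hN : (N : ℤ) ∣ d * d + t * d + 1) (r : ZMod N) (hr : ((d : ℤ) : ZMod N) = r) :
    ∀ β : Gamma0 N, (β : SL(2, ℤ)) 0 1 = -1 → ((((β : SL(2, ℤ)) 1 1 : ℤ) : ZMod N)) = r → χ β = 0 :=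
  fun β hb hd ↦ chi_eq_zero_of_b_neg_one_of_elliptic hadd hsmall β hb d t ht hN (by rw [hd, hr])

/-- **Rule `η = +1` in residue form.** Given integers with `a₁d₁ + c₁ = 1`, `a₂d₂ + c₂ = 1`, `N ∣ c₁, c₂`, `a₁ + d₂ = 1`, and residues
`u = d₁`, `v = d₂`, `w = d₁d₂`: any two of `K(u), K(v), K(w)` imply the third. [folklore] -/
theorem K_rule_pos (hadd : ∀ γ δ : Gamma0 N, χ (γ * δ) = χ γ + χ δ)
    (hsmall : ∀ γ : Gamma0 N, ((γ : SL(2, ℤ)) 0 0 + (γ : SL(2, ℤ)) 1 1).natAbs ≤ 2 → χ γ = 0)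
    (a₁ d₁ c₁ a₂ d₂ c₂ : ℤ) (h1 : a₁ * d₁ + c₁ = 1) (hc1 : (N : ℤ) ∣ c₁) (h2 : a₂ * d₂ + c₂ = 1) (hc2 : (N : ℤ) ∣ c₂)
    (h12 : a₁ + d₂ = 1) (u v w : ZMod N) (hu : ((d₁ : ℤ) : ZMod N) = u) (hv : ((d₂ : ℤ) : ZMod N) = v)
    (hw : ((d₁ * d₂ : ℤ) : ZMod N) = w) :
    ((∀ β : Gamma0 N, (β : SL(2, ℤ)) 0 1 = -1 → ((((β : SL(2, ℤ)) 1 1 : ℤ) : ZMod N)) = u → χ β = 0) →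
      (∀ β : Gamma0 N, (β : SL(2, ℤ)) 0 1 = -1 → ((((β : SL(2, ℤ)) 1 1 : ℤ) : ZMod N)) = v → χ β = 0) →
      (∀ β : Gamma0 N, (β : SL(2, ℤ)) 0 1 = -1 → ((((β : SL(2, ℤ)) 1 1 : ℤ) : ZMod N)) = w → χ β = 0)) ∧
    ((∀ β : Gamma0 N, (β : SL(2, ℤ)) 0 1 = -1 → ((((β : SL(2, ℤ)) 1 1 : ℤ) : ZMod N)) = u → χ β = 0) →
      (∀ β : Gamma0 N, (β : SL(2, ℤ)) 0 1 = -1 → ((((β : SL(2, ℤ)) 1 1 : ℤ) : ZMod N)) = w → χ β = 0) →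
      (∀ β : Gamma0 N, (β : SL(2, ℤ)) 0 1 = -1 → ((((β : SL(2, ℤ)) 1 1 : ℤ) : ZMod N)) = v → χ β = 0)) ∧
    ((∀ β : Gamma0 N, (β : SL(2, ℤ)) 0 1 = -1 → ((((β : SL(2, ℤ)) 1 1 : ℤ) : ZMod N)) = v → χ β = 0) →
      (∀ β : Gamma0 N, (β : SL(2, ℤ)) 0 1 = -1 → ((((β : SL(2, ℤ)) 1 1 : ℤ) : ZMod N)) = w → χ β = 0) →
      (∀ β : Gamma0 N, (β : SL(2, ℤ)) 0 1 = -1 → ((((β : SL(2, ℤ)) 1 1 : ℤ) : ZMod N)) = u → χ β = 0)) := by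
  obtain ⟨β₁, h100, h101, h110, h111⟩ :=
    ThetaLayerLambdaCongruenceAtTwo.exists_gamma0_entries (N := N) a₁ (-1) c₁ d₁ (by linear_combination h1) hc1
  obtain ⟨β₂, h200, h201, h210, h211⟩ :=
    ThetaLayerLambdaCongruenceAtTwo.exists_gamma0_entries (N := N) a₂ (-1) c₂ d₂ (by linear_combination h2) hc2
  have hb : ((β₁ * β₂ : Gamma0 N) : SL(2, ℤ)) 0 1 = -1 := by
    rw [gamma0_mul_apply_zero_one, h100, h201, h101, h211]; linear_combination (-1 : ℤ) * h12
  have hc : (((β₁ : SL(2, ℤ)) 1 0 : ℤ) : ZMod N) = 0 := by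
    rw [h110]; exact (ZMod.intCast_zmod_eq_zero_iff_dvd _ N).mpr hc1
  have hdw : ((((β₁ * β₂ : Gamma0 N) : SL(2, ℤ)) 1 1 : ℤ) : ZMod N) = w := by
    rw [gamma0_mul_apply_one_one', h201, h111, h211, ← hw]; push_cast; rw [hc]; ring
  have hd1 : ((((β₁ : SL(2, ℤ)) 1 1 : ℤ) : ZMod N)) = u := by rw [h111, hu]
  have hd2 : ((((β₂ : SL(2, ℤ)) 1 1 : ℤ) : ZMod N)) = v := by rw [h211, hv]
  have heq : χ β₁ + χ β₂ = χ (β₁ * β₂) := (hadd β₁ β₂).symm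
  refine ⟨fun Ku Kv β hβ hd ↦ ?_, fun Ku Kw β hβ hd ↦ ?_, fun Kv Kw β hβ hd ↦ ?_⟩
  · rw [chi_eq_of_apply_zero_one_eq_neg_one hadd hsmall hβ hb (by rw [hd, hdw]), ← heq, Ku β₁ h101 hd1, Kv β₂ h201 hd2,
      add_zero]
  · rw [chi_eq_of_apply_zero_one_eq_neg_one hadd hsmall hβ h201 (by rw [hd, hd2])]
    have := Kw _ hb hdw
    rw [← heq, Ku β₁ h101 hd1, zero_add] at this
    exact this
  · rw [chi_eq_of_apply_zero_one_eq_neg_one hadd hsmall hβ h101 (by rw [hd, hd1])]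
    have := Kw _ hb hdw
    rw [← heq, Kv β₂ h201 hd2, add_zero] at this
    exact this

/-- **Rule `η = −1` in residue form.** As above with `a₁ + d₂ = −1` and `w = a₁a₂` (the inverse of `β₁β₂` has `b = −1`, `d ≡ a₁a₂`).
[folklore] -/
theorem K_rule_neg (hadd : ∀ γ δ : Gamma0 N, χ (γ * δ) = χ γ + χ δ)
    (hsmall : ∀ γ : Gamma0 N, ((γ : SL(2, ℤ)) 0 0 + (γ : SL(2, ℤ)) 1 1).natAbs ≤ 2 → χ γ = 0)
    (a₁ d₁ c₁ a₂ d₂ c₂ : ℤ) (h1 : a₁ * d₁ + c₁ = 1) (hc1 : (N : ℤ) ∣ c₁) (h2 : a₂ * d₂ + c₂ = 1) (hc2 : (N : ℤ) ∣ c₂)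
    (h12 : a₁ + d₂ = -1) (u v w : ZMod N) (hu : ((d₁ : ℤ) : ZMod N) = u) (hv : ((d₂ : ℤ) : ZMod N) = v)
    (hw : ((a₁ * a₂ : ℤ) : ZMod N) = w) :
    ((∀ β : Gamma0 N, (β : SL(2, ℤ)) 0 1 = -1 → ((((β : SL(2, ℤ)) 1 1 : ℤ) : ZMod N)) = u → χ β = 0) →
      (∀ β : Gamma0 N, (β : SL(2, ℤ)) 0 1 = -1 → ((((β : SL(2, ℤ)) 1 1 : ℤ) : ZMod N)) = v → χ β = 0) →
      (∀ β : Gamma0 N, (β : SL(2, ℤ)) 0 1 = -1 → ((((β : SL(2, ℤ)) 1 1 : ℤ) : ZMod N)) = w → χ β = 0)) ∧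
    ((∀ β : Gamma0 N, (β : SL(2, ℤ)) 0 1 = -1 → ((((β : SL(2, ℤ)) 1 1 : ℤ) : ZMod N)) = u → χ β = 0) →
      (∀ β : Gamma0 N, (β : SL(2, ℤ)) 0 1 = -1 → ((((β : SL(2, ℤ)) 1 1 : ℤ) : ZMod N)) = w → χ β = 0) →
      (∀ β : Gamma0 N, (β : SL(2, ℤ)) 0 1 = -1 → ((((β : SL(2, ℤ)) 1 1 : ℤ) : ZMod N)) = v → χ β = 0)) ∧
    ((∀ β : Gamma0 N, (β : SL(2, ℤ)) 0 1 = -1 → ((((β : SL(2, ℤ)) 1 1 : ℤ) : ZMod N)) = v → χ β = 0) →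
      (∀ β : Gamma0 N, (β : SL(2, ℤ)) 0 1 = -1 → ((((β : SL(2, ℤ)) 1 1 : ℤ) : ZMod N)) = w → χ β = 0) →
      (∀ β : Gamma0 N, (β : SL(2, ℤ)) 0 1 = -1 → ((((β : SL(2, ℤ)) 1 1 : ℤ) : ZMod N)) = u → χ β = 0)) := by
  obtain ⟨β₁, h100, h101, h110, h111⟩ :=
    ThetaLayerLambdaCongruenceAtTwo.exists_gamma0_entries (N := N) a₁ (-1) c₁ d₁ (by linear_combination h1) hc1
  obtain ⟨β₂, h200, h201, h210, h211⟩ :=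
    ThetaLayerLambdaCongruenceAtTwo.exists_gamma0_entries (N := N) a₂ (-1) c₂ d₂ (by linear_combination h2) hc2
  have hb1 : ((β₁ * β₂ : Gamma0 N) : SL(2, ℤ)) 0 1 = 1 := by
    rw [gamma0_mul_apply_zero_one, h100, h201, h101, h211]; linear_combination (-1 : ℤ) * h12
  have hb : (((β₁ * β₂)⁻¹ : Gamma0 N) : SL(2, ℤ)) 0 1 = -1 := by
    have e : (((β₁ * β₂)⁻¹ : Gamma0 N) : SL(2, ℤ)) 0 1 = -(((β₁ * β₂ : Gamma0 N) : SL(2, ℤ)) 0 1) := by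
      rw [InvMemClass.coe_inv, Matrix.SpecialLinearGroup.SL2_inv_expl]; rfl
    rw [e, hb1]
  have hc : (((β₂ : SL(2, ℤ)) 1 0 : ℤ) : ZMod N) = 0 := by
    rw [h210]; exact (ZMod.intCast_zmod_eq_zero_iff_dvd _ N).mpr hc2
  have hdw : (((((β₁ * β₂)⁻¹ : Gamma0 N) : SL(2, ℤ)) 1 1 : ℤ) : ZMod N) = w := by
    rw [coe_inv_apply_one_one, gamma0_mul_apply_zero_zero', h100, h101, h200, ← hw]; push_cast; rw [hc]; ring
  have hd1 : ((((β₁ : SL(2, ℤ)) 1 1 : ℤ) : ZMod N)) = u := by rw [h111, hu]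
  have hd2 : ((((β₂ : SL(2, ℤ)) 1 1 : ℤ) : ZMod N)) = v := by rw [h211, hv]
  have h1' : χ 1 = 0 := by have := hadd 1 1; rw [mul_one] at this; linear_combination (-1 : ZMod 2) * this
  have hinv : χ (β₁ * β₂)⁻¹ = χ (β₁ * β₂) := by
    have := hadd (β₁ * β₂) (β₁ * β₂)⁻¹
    rw [mul_inv_cancel, h1'] at this
    have e : χ (β₁ * β₂)⁻¹ = -χ (β₁ * β₂) := by linear_combination (-1 : ZMod 2) * this
    rw [e, ZMod.neg_eq_self_mod_two]
  have heq : χ β₁ + χ β₂ = χ (β₁ * β₂)⁻¹ := by rw [hinv, hadd]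
  refine ⟨fun Ku Kv β hβ hd ↦ ?_, fun Ku Kw β hβ hd ↦ ?_, fun Kv Kw β hβ hd ↦ ?_⟩
  · rw [chi_eq_of_apply_zero_one_eq_neg_one hadd hsmall hβ hb (by rw [hd, hdw]), ← heq, Ku β₁ h101 hd1, Kv β₂ h201 hd2,
      add_zero]
  · rw [chi_eq_of_apply_zero_one_eq_neg_one hadd hsmall hβ h201 (by rw [hd, hd2])]
    have := Kw _ hb hdw
    rw [← heq, Ku β₁ h101 hd1, zero_add] at this
    exact this
  · rw [chi_eq_of_apply_zero_one_eq_neg_one hadd hsmall hβ h101 (by rw [hd, hd1])]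
    have := Kw _ hb hdw
    rw [← heq, Kv β₂ h201 hd2, add_zero] at this
    exact this

end Summit.BirchSwinnertonDyer.BirchSwinnertonDyer.Theorems.SignedMuAtTwo

end
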